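import Summits.Parity.GeneralizedHardyLittlewood.Theorems.LiouvilleShiftedTablesTypeI2DilatedAssemble1

/-!
# THE ASSEMBLY of the line `peel-to-drappeau` for the crux `TypeI2Dilated` (stmt-Parity-14272)

Part 2/6: the two crux classes are one class `mod lcm(rs, q)` (`classFilter_empty_or_modEq`), its normal form `bvCls`/`bvU`, and `|J| ≤ 1 + |BV prefix|` (`abs_classSum_le_bv`).

Route `LiouvilleShiftedTables` (Parity / GeneralizedHardyLittlewood); registered skeleton
`Cruxes/TypeI2Dilated/Lines/peel-to-drappeau.lean` (v6), stub `stub_assembleFrom : AssembleFrom` where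
`AssembleFrom := URBound → (DilatedTypeII → DilatedMainTerms → DilatedDivisorAP → BVLiouville → TypeI2Dilated)`
(vocabulary in `Summits.Parity.GeneralizedHardyLittlewood.Theorems.LiouvilleShiftedTablesDefs`).  The paper proof with constants and the audit of the four inputs is the
second module docstring of part 5. [this line: Lines/peel-to-drappeau.md]
-/

noncomputable section

namespace Summit.Parity.GeneralizedHardyLittlewood.Cruxes.TypeI2Dilated.PeelToDrappeau

open Finset Real
open scoped ArithmeticFunction.sigma Classical
open Literature.NumberTheory.Sieve Literature.NumberTheory.Sieve.Drappeau2017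
  Literature.NumberTheory.Sieve.FouvryTenenbaum2021 Literature.NumberTheory.Sieve.DispersionAssembly
open Summit.Parity.GeneralizedHardyLittlewood.Theses.LiouvilleShiftedTables (TypeI2Dilated BVLiouville)

/-- The two classes `c (mod e)`, `w + c (mod q)` cut out either nothing or one class `mod lcm(e, q)`.
[folklore] -/
theorem classFilter_empty_or_modEq (c : ℤ) {q : ℕ} (hq : 1 ≤ q) (w : ℕ) {e : ℕ} (he : 1 ≤ e) (Y : ℝ) :
    classFilter c q w e Y = ∅ ∨ ∃ a : ℕ, a < Nat.lcm e q ∧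
      classFilter c q w e Y = (Icc 1 ⌊Y⌋₊).filter (fun m : ℕ => m ≡ a [MOD Nat.lcm e q]) := by
  by_cases h : (classFilter c q w e Y).Nonempty
  · right
    obtain ⟨m₀, hm₀⟩ := h
    have hd : 0 < Nat.lcm e q := Nat.lcm_pos he hq
    refine ⟨m₀ % Nat.lcm e q, Nat.mod_lt _ hd, ?_⟩
    rw [classFilter, Finset.mem_filter] at hm₀
    obtain ⟨-, h1, h2⟩ := hm₀
    ext m
    simp only [classFilter, Finset.mem_filter]
    have key : ((m : ZMod e) = ((c : ℤ) : ZMod e) ∧ (m : ZMod q) = (((w : ℤ) + c : ℤ) : ZMod q)) ↔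
        m ≡ m₀ % Nat.lcm e q [MOD Nat.lcm e q] := by
      rw [← h1, ← h2, ZMod.natCast_eq_natCast_iff, ZMod.natCast_eq_natCast_iff,
        ← Int.natCast_modEq_iff, ← Int.natCast_modEq_iff, ← Int.natCast_modEq_iff,
        Int.modEq_and_modEq_iff_modEq_lcm]
      have hl : ((e : ℤ).lcm (q : ℤ) : ℤ) = ((Nat.lcm e q : ℕ) : ℤ) := by
        rw [Int.lcm_def]; rfl
      rw [hl, Int.natCast_modEq_iff, Int.natCast_modEq_iff]
      exact ⟨fun h => h.trans (Nat.mod_modEq m₀ _).symm, fun h => h.trans (Nat.mod_modEq m₀ _)⟩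
    rw [key]
  · left
    exact Finset.not_nonempty_iff_eq_empty.1 h

/-- The normalised class `a ∈ [0, lcm(e,q))` cut out by `classFilter c q w e Y` (or `0` if empty). [this line] -/
def bvCls (c : ℤ) (q w e : ℕ) (Y : ℝ) : ℕ :=
  if h : ∃ a : ℕ, a < Nat.lcm e q ∧
      classFilter c q w e Y = (Icc 1 ⌊Y⌋₊).filter (fun m : ℕ => m ≡ a [MOD Nat.lcm e q])
  then Classical.choose h else 0

/-- The length of the Bombieri–Vinogradov prefix attached to `classFilter c q w e Y`. [this line] -/
def bvU (c : ℤ) (q w e : ℕ) (Y : ℝ) : ℕ := (⌊Y⌋₊ - bvCls c q w e Y) / Nat.lcm e q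

/-- `bvCls < lcm(e, q)`. [this line] -/
theorem bvCls_lt (c : ℤ) {q : ℕ} (hq : 1 ≤ q) (w : ℕ) {e : ℕ} (he : 1 ≤ e) (Y : ℝ) :
    bvCls c q w e Y < Nat.lcm e q := by
  unfold bvCls
  split_ifs with h
  · exact (Classical.choose_spec h).1
  · exact Nat.lcm_pos he hq

/-- `classFilter` is empty or the class `bvCls (mod lcm(e,q))`. [this line] -/
theorem classFilter_eq_empty_or_bvCls (c : ℤ) {q : ℕ} (hq : 1 ≤ q) (w : ℕ) {e : ℕ} (he : 1 ≤ e) (Y : ℝ) :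
    classFilter c q w e Y = ∅ ∨ classFilter c q w e Y =
      (Icc 1 ⌊Y⌋₊).filter (fun m : ℕ => m ≡ bvCls c q w e Y [MOD Nat.lcm e q]) := by
  rcases classFilter_empty_or_modEq c hq w he Y with h | h
  · exact Or.inl h
  · right
    unfold bvCls
    rw [dif_pos h]
    exact (Classical.choose_spec h).2

/-- `|J(q, e)| ≤ 1 + |∑_{n ≤ U} λ(d n + a)|` with `d = lcm(e, q)`, `a = bvCls`, `U = bvU`. [this line] -/
theorem abs_classSum_le_bv (c : ℤ) {q : ℕ} (hq : 1 ≤ q) (w : ℕ) {e : ℕ} (he : 1 ≤ e) (Y : ℝ) :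
    |classSum c q w e Y| ≤ 1 + |∑ n ∈ Icc 1 (bvU c q w e Y),
      (ArithmeticFunction.liouville (Nat.lcm e q * n + bvCls c q w e Y) : ℝ)| := by
  unfold classSum
  rcases classFilter_eq_empty_or_bvCls c hq w he Y with h | h
  · rw [h, Finset.sum_empty, abs_zero]
    positivity
  · rw [h, sum_Icc_filter_modEq _ (Nat.lcm_pos he hq) (bvCls_lt c hq w he Y), bvU]
    refine (abs_add_le _ _).trans (add_le_add ?_ le_rfl)
    split_ifs with h1
    · rw [Negative.abs_liouville_eq_one (by omega)]
    · simp

/-- Landing anchor of the split assembly chain (file 2 of 6): a registered, mathematically vacuous sub-goal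
(`ledger workitem stub-add … --name assembleChain2_anchor --signature 'True'`) so that this intermediate file passes
the gate's supports check; the registered stub `stub_assembleFrom` is proved in file 6. [this line] -/
theorem assembleChain2_anchor : True := trivial

end Summit.Parity.GeneralizedHardyLittlewood.Cruxes.TypeI2Dilated.PeelToDrappeau

end
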